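import Literature.AlgebraicGeometry.Frobenioids.ArchimedeanProp35ivCounterexampleConnected
import Literature.AlgebraicGeometry.Frobenioids.ArchimedeanProp35ivSplitMono
import HarnessLib

/-!
# Frobenioids II, Proposition 3.5 (iv) for the ANGULAR Frobenioid `A` as typed (`ArchFrd.Prop35iv_A`,
# FACT-LIST F-0865): a COUNTEREXAMPLE over a CONNECTED base, and the dichotomy for (iv)

Mochizuki, *The geometry of Frobenioids II: poly-Frobenioids*, Kyushu J. Math. **62** (2008) 401–460,
§3, Proposition 3.5 (iv), kurims p. 34 [cite: MochizukiFrdII2008, Prop 3.5 (iv) p.34] ("`F` is not of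
RC-iso-subanchor type", `F = C, A` over a CONNECTED, TOTALLY EPIMORPHIC base of RC-iso-subanchor type;
[FrdII] Def. 3.1 (v) p. 25 [cite: MochizukiFrdII2008, Def 3.1 (v) p.25]; [FrdI] §0 p. 18
[cite: MochizukiFrdI2008, §0 p.18]).

PROOF-ONLY companion (seat abc-iut-f-014, block F), the twin for `A` of
`ArchimedeanProp35ivCounterexampleConnected.lean` (`F = C`). Over the connected three-object base `T → D₀`
(`ArchimedeanProp35iiToyBase(RC).lean`; of RC-iso-subanchor type, NOT totally epimorphic) the angular
Frobenioid `A_T ⊆ C_T` (isometries) IS of RC-iso-subanchor type: every object `(X₀, p, ι)` over the point is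
an RC-anchor of `A` (no arrow of `A[ℂ]` out of it is irreducible — the factorisation through the retract
`p → e → p` consists of isometries), every object is an RC-subanchor via the isometries `(1, x → p)`, and
the presentations of the `C`-twin are presentations in `A` (`(1, c → p)` by `{γ | γ_{C₀} = 1}`, identities by
the trivial group). Hence **`not_prop35iv_A`**, **`not_forall_prop35iv_A_of_isGraphConnected`**,
`exists_connected_base_not_prop35iv_A`; and, with `ArchimedeanProp35ivSplitMono.lean`, the DICHOTOMY
**`prop35iv_splitMono_dichotomy`**: the typed Prop. 3.5 (iv) for `C` and `A` holds over every nonempty base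
whose split monomorphisms are invertible and fails over a connected base with ONE non-invertible split
monomorphism — sharper than the empty-base refutation `ArchFrd.not_forall_prop35iv_A` (abc-iut-f-007).

A statement about OUR typed row (the schema omits «totally epimorphic»); print is unaffected. Nothing here
bears on [IUTchIII] Cor. 3.12; typed ≠ proved except where a `theorem` says so.
-/

namespace Literature.AlgebraicGeometry.Frobenioids

open CategoryTheory

noncomputable section

universe v u

namespace ArchFrd

namespace P35iiToy

/-! ### Objects and isometries of `A_T` with prescribed `C₀`-part -/

/-- Every object of `A_T` is complex for `A → T → D₀ → ArchBase`. [cite: MochizukiFrdII2008, Def 3.1 (v) p.24] -/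
theorem complexObjects_A (X : A toD0) : RC.complexObjects (A.rcOf toD0) X :=
  (D0.isComplex_toArchBase_iff _).mpr rfl

/-- The arrows `(1, g) : (X₀, x, ι) → (X₀, y, ι)` of `C_T` are isometries (arrows of `A_T`).
[cite: MochizukiFrdII2008, Ex 3.3 (iii) p.29] -/
theorem isIsometry_idHom (X₀ : C0) (ι : (PreFrobenioid.baseFunctor C0.toElem).obj X₀ ≅ D0.complex)
    {x y : T} (g : x ⟶ y) :
    PreFrobenioid.IsIsometry (C.toElem toD0)
      (⟨𝟙 X₀, g, w_id X₀ ι g⟩ : (⟨X₀, x, ι⟩ : C toD0) ⟶ ⟨X₀, y, ι⟩) :=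
  (PreFrobenioid.isIsometry_fiberProduct_iff _).2 (PreFrobenioid.div_id C0.toElem X₀)

/-! ### Objects over the point are RC-anchors of `A` -/

/-- **No arrow of `A[ℂ]` out of an object over `p` is irreducible**: the factorisation
`(φ₀, g) = (1, p → e) ≫ (φ₀, e → p ≫ g)` of `C` consists of isometries when `(φ₀, g)` is one.
[cite: MochizukiFrdI2008, §0 p.18] -/
theorem not_isIrreducibleHom_complexPartA_over_p (X₀ : C0)
    (ι : (PreFrobenioid.baseFunctor C0.toElem).obj X₀ ≅ D0.complex) {Y : RC.ComplexPart (A.rcOf toD0)}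
    (φ : (⟨⟨⟨X₀, T.p, ι⟩⟩, complexObjects_A _⟩ : RC.ComplexPart (A.rcOf toD0)) ⟶ Y) :
    ¬ IsIrreducibleHom φ := by
  intro hφ
  obtain ⟨⟨⟨Y₀, y, ιY⟩⟩, hY⟩ := Y
  have hαiso : PreFrobenioid.IsIsometry (C.toElem toD0)
      (⟨φ.hom.hom.fst, T.ret ≫ φ.hom.hom.snd, φ.hom.hom.w⟩ : (⟨X₀, T.e, ι⟩ : C toD0) ⟶ ⟨Y₀, y, ιY⟩) :=
    (PreFrobenioid.isIsometry_fiberProduct_iff _).2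
      ((PreFrobenioid.isIsometry_fiberProduct_iff _).1 φ.hom.property)
  let M : RC.ComplexPart (A.rcOf toD0) := ⟨⟨⟨X₀, T.e, ι⟩⟩, complexObjects_A _⟩
  let β : (⟨⟨⟨X₀, T.p, ι⟩⟩, complexObjects_A _⟩ : RC.ComplexPart (A.rcOf toD0)) ⟶ M :=
    ObjectProperty.homMk ⟨⟨𝟙 X₀, T.sec false, w_id X₀ ι _⟩, isIsometry_idHom X₀ ι _⟩
  let α : M ⟶ ⟨⟨⟨Y₀, y, ιY⟩⟩, hY⟩ :=
    ObjectProperty.homMk ⟨⟨φ.hom.hom.fst, T.ret ≫ φ.hom.hom.snd, φ.hom.hom.w⟩, hαiso⟩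
  have hC : (⟨𝟙 X₀, T.sec false, w_id X₀ ι _⟩ : (⟨X₀, T.p, ι⟩ : C toD0) ⟶ ⟨X₀, T.e, ι⟩) ≫
      (⟨φ.hom.hom.fst, T.ret ≫ φ.hom.hom.snd, φ.hom.hom.w⟩ : (⟨X₀, T.e, ι⟩ : C toD0) ⟶ ⟨Y₀, y, ιY⟩) =
        φ.hom.hom := by
    refine CFP.hom_ext (Category.id_comp _) ?_
    change T.sec false ≫ T.ret ≫ φ.hom.hom.snd = φ.hom.hom.snd
    rw [← Category.assoc, T.sec_comp_ret, Category.id_comp]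
  have hfac : β ≫ α = φ := ObjectProperty.hom_ext _ (WideSubcategory.hom_ext _ hC)
  rcases hφ.2 β α hfac with hα | hβ
  · haveI := hα
    haveI : IsIso α.hom.hom := (inferInstance : IsIso ((A.ι toD0).map α.hom))
    have hs : IsIso (T.ret ≫ φ.hom.hom.snd) := CFP.isIso_snd α.hom.hom
    cases y with
    | c => exact (T.isEmpty_hom_pc.false φ.hom.hom.snd).elim
    | p =>
      rw [Subsingleton.elim (T.ret ≫ φ.hom.hom.snd) T.ret] at hs
      exact T.not_isIso_ret hs
    | e =>
      obtain ⟨i, hi⟩ := T.hom_pe_eq φ.hom.hom.snd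
      rw [hi, T.ret_comp_sec] at hs
      exact T.not_isIso_emap_const i hs
  · haveI := hβ
    haveI : IsIso β.hom.hom := (inferInstance : IsIso ((A.ι toD0).map β.hom))
    exact T.not_isIso_sec false (CFP.isIso_snd β.hom.hom)

/-- **Every object of `A_T` over the point is an RC-anchor of `A`.** [cite: MochizukiFrdII2008, Def 3.1 (v) p.25] -/
theorem isRCAnchorA_over_p (X₀ : C0) (ι : (PreFrobenioid.baseFunctor C0.toElem).obj X₀ ≅ D0.complex) :
    RC.IsRCAnchor (A.rcOf toD0) (⟨⟨X₀, T.p, ι⟩⟩ : A toD0) := by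
  refine ⟨complexObjects_A _, Set.Finite.subset Set.finite_empty ?_⟩
  rintro x ⟨f, hf, -⟩
  exact (not_isIrreducibleHom_complexPartA_over_p X₀ ι f.hom hf).elim

/-- **Every object of `A_T` is an RC-subanchor** (via the isometry `(1, x → p)`).
[cite: MochizukiFrdII2008, Def 3.1 (v) p.25] -/
theorem isRCSubanchor_A (X : A toD0) : RC.IsRCSubanchor (A.rcOf toD0) X := by
  obtain ⟨⟨X₀, x, ι⟩⟩ := X
  refine ⟨⟨⟨X₀, T.p, ι⟩⟩, isRCAnchorA_over_p X₀ ι, ?_⟩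
  cases x with
  | c => exact ⟨⟨⟨𝟙 X₀, T.quot, w_id X₀ ι _⟩, isIsometry_idHom X₀ ι _⟩⟩
  | p => exact ⟨⟨⟨𝟙 X₀, 𝟙 T.p, w_id X₀ ι _⟩, isIsometry_idHom X₀ ι _⟩⟩
  | e => exact ⟨⟨⟨𝟙 X₀, T.ret, w_id X₀ ι _⟩, isIsometry_idHom X₀ ι _⟩⟩

/-! ### Mono-minimal categorical quotient presentations in `A_T` -/

/-- **`(1, c → p)` is a MONO-MINIMAL CATEGORICAL QUOTIENT in `A` of `(X₀, c, ι)` by `{γ | γ_{C₀} = 1} ∋ (1, σ)`.**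
[cite: MochizukiFrdI2008, §0 p.18] -/
theorem exists_isMonoMinimalQuotientA_over_p (X₀ : C0)
    (ι : (PreFrobenioid.baseFunctor C0.toElem).obj X₀ ≅ D0.complex) :
    ∃ G : Subgroup (Aut (⟨⟨X₀, T.c, ι⟩⟩ : A toD0)),
      IsMonoMinimalQuotient G
        (⟨⟨𝟙 X₀, T.quot, w_id X₀ ι _⟩, isIsometry_idHom X₀ ι _⟩ :
          (⟨⟨X₀, T.c, ι⟩⟩ : A toD0) ⟶ ⟨⟨X₀, T.p, ι⟩⟩) := by
  -- the swap `(1, σ)` as an automorphism in `A`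
  let σh : (⟨⟨X₀, T.c, ι⟩⟩ : A toD0) ⟶ ⟨⟨X₀, T.c, ι⟩⟩ :=
    ⟨⟨𝟙 X₀, T.sw, w_id X₀ ι _⟩, isIsometry_idHom X₀ ι _⟩
  have hσσ : σh ≫ σh = 𝟙 _ :=
    WideSubcategory.hom_ext _ (CFP.hom_ext (Category.id_comp _) T.sw_comp_sw)
  let σ : (⟨⟨X₀, T.c, ι⟩⟩ : A toD0) ≅ ⟨⟨X₀, T.c, ι⟩⟩ := ⟨σh, σh, hσσ, hσσ⟩
  have hσfst : σ.hom.hom.fst = 𝟙 X₀ := rfl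
  have hσne : σ.hom ≠ 𝟙 _ := fun h => T.sw_ne_id (congrArg (fun k => k.hom.snd) h)
  refine ⟨{ carrier := {γ | γ.hom.hom.fst = 𝟙 _}
            one_mem' := rfl
            mul_mem' := fun {γ δ} hγ hδ => ?_
            inv_mem' := fun {γ} hγ => ?_ }, ⟨fun γ hγ => ?_, fun X ψ hψ => ?_⟩,
          fun A' ζ φ' hfac hmono _ => ?_⟩
  · change (δ.hom.hom ≫ γ.hom.hom).fst = 𝟙 _
    rw [CFP.comp_fst, show γ.hom.hom.fst = 𝟙 _ from hγ, show δ.hom.hom.fst = 𝟙 _ from hδ,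
      Category.comp_id]
  · change γ.inv.hom.fst = 𝟙 _
    have h : (γ.hom ≫ γ.inv).hom.fst = 𝟙 _ := by rw [γ.hom_inv_id]; rfl
    change (γ.hom.hom ≫ γ.inv.hom).fst = 𝟙 _ at h
    rwa [CFP.comp_fst, show γ.hom.hom.fst = 𝟙 _ from hγ, Category.id_comp] at h
  · -- (a) `G`-invariance
    apply WideSubcategory.hom_ext
    change γ.hom.hom ≫ (⟨𝟙 X₀, T.quot, w_id X₀ ι _⟩ : (⟨X₀, T.c, ι⟩ : C toD0) ⟶ ⟨X₀, T.p, ι⟩) = _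
    refine CFP.hom_ext ?_ (Subsingleton.elim _ _)
    rw [CFP.comp_fst, show γ.hom.hom.fst = 𝟙 _ from hγ, Category.id_comp]
  · -- (b) unique factorisation of `G`-invariant arrows
    have hsw : T.sw ≫ ψ.hom.snd = ψ.hom.snd := congrArg (fun k => k.hom.snd) (hψ σ hσfst)
    have hfst : ∀ ψ' : (⟨⟨X₀, T.p, ι⟩⟩ : A toD0) ⟶ X,
        (⟨⟨𝟙 X₀, T.quot, w_id X₀ ι _⟩, isIsometry_idHom X₀ ι _⟩ :
            (⟨⟨X₀, T.c, ι⟩⟩ : A toD0) ⟶ ⟨⟨X₀, T.p, ι⟩⟩) ≫ ψ' = ψ →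
          ψ'.hom.fst = ψ.hom.fst := fun ψ' h => by
      have h1 := congrArg (fun k => k.hom.fst) h
      change (𝟙 X₀ ≫ ψ'.hom.fst) = ψ.hom.fst at h1
      rwa [Category.id_comp] at h1
    obtain ⟨⟨Y₀, y, ιY⟩⟩ := X
    have hψ'iso : ∀ (g : T.p ⟶ y)
        (w : (PreFrobenioid.baseFunctor C0.toElem).map ψ.hom.fst ≫ ιY.hom = ι.hom ≫ toD0.map g),
        PreFrobenioid.IsIsometry (C.toElem toD0) (⟨ψ.hom.fst, g, w⟩ : (⟨X₀, T.p, ι⟩ : C toD0) ⟶ ⟨Y₀, y, ιY⟩) :=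
      fun g w => (PreFrobenioid.isIsometry_fiberProduct_iff _).2
        ((PreFrobenioid.isIsometry_fiberProduct_iff _).1 ψ.property)
    cases y with
    | c => exact (T.sw_comp_ne_self ψ.hom.snd hsw).elim
    | p =>
      refine ⟨⟨⟨ψ.hom.fst, 𝟙 _, ψ.hom.w⟩, hψ'iso _ _⟩, ?_, fun ψ' hψ' => ?_⟩
      · apply WideSubcategory.hom_ext
        change (⟨𝟙 X₀, T.quot, w_id X₀ ι _⟩ : (⟨X₀, T.c, ι⟩ : C toD0) ⟶ ⟨X₀, T.p, ι⟩) ≫ _ = ψ.hom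
        exact CFP.hom_ext (Category.id_comp _) (Subsingleton.elim _ _)
      · apply WideSubcategory.hom_ext
        exact CFP.hom_ext (hfst ψ' hψ') (Subsingleton.elim _ _)
    | e =>
      obtain ⟨i, hi⟩ := T.hom_ce_eq ψ.hom.snd
      refine ⟨⟨⟨ψ.hom.fst, T.sec i, ψ.hom.w⟩, hψ'iso _ _⟩, ?_, fun ψ' hψ' => ?_⟩
      · apply WideSubcategory.hom_ext
        change (⟨𝟙 X₀, T.quot, w_id X₀ ι _⟩ : (⟨X₀, T.c, ι⟩ : C toD0) ⟶ ⟨X₀, T.p, ι⟩) ≫ _ = ψ.hom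
        refine CFP.hom_ext (Category.id_comp _) ?_
        change T.quot ≫ T.sec i = ψ.hom.snd
        rw [T.quot_comp_sec, hi]
      · apply WideSubcategory.hom_ext
        refine CFP.hom_ext (hfst ψ' hψ') ?_
        obtain ⟨j, hj⟩ := T.hom_pe_eq ψ'.hom.snd
        have h2 := congrArg (fun k => k.hom.snd) hψ'
        change T.quot ≫ ψ'.hom.snd = ψ.hom.snd at h2
        rw [hj, T.quot_comp_sec, hi] at h2
        change ψ'.hom.snd = T.sec i
        rw [hj, T.cst_injective h2]
  · -- mono-minimality
    obtain ⟨⟨A₀, a, ιA⟩⟩ := A'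
    have hσζ : σ.hom ≫ ζ = 𝟙 _ ≫ ζ → False := fun h => hσne ((cancel_mono ζ).mp h)
    have hfstζ : (σ.hom.hom ≫ ζ.hom).fst =
        ((𝟙 (⟨⟨X₀, T.c, ι⟩⟩ : A toD0) : (⟨⟨X₀, T.c, ι⟩⟩ : A toD0) ⟶ ⟨⟨X₀, T.c, ι⟩⟩).hom ≫ ζ.hom).fst := by
      rw [CFP.comp_fst, CFP.comp_fst]
      rfl
    cases a with
    | c =>
      haveI : IsIso ζ.hom.snd := T.isIso_hom_cc ζ.hom.snd
      have h1 : ζ.hom.fst ≫ φ'.hom.fst = 𝟙 _ := by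
        have h := congrArg (fun k => k.hom.fst) hfac
        change (ζ.hom ≫ φ'.hom).fst = 𝟙 _ at h
        rwa [CFP.comp_fst] at h
      haveI : IsSplitMono ζ.hom.fst := IsSplitMono.mk' ⟨φ'.hom.fst, h1⟩
      haveI : Epi ζ.hom.fst := C0.isTotallyEpimorphic.epi ζ.hom.fst
      haveI : IsIso ζ.hom.fst := isIso_of_epi_of_isSplitMono ζ.hom.fst
      haveI : IsIso ζ.hom := CFP.isIso_of_isIso_fst_snd ζ.hom
      exact A.isIso_of_isIso_hom ζ
    | p => exact (hσζ (WideSubcategory.hom_ext _ (CFP.hom_ext hfstζ (Subsingleton.elim _ _)))).elim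
    | e =>
      refine (hσζ (WideSubcategory.hom_ext _ (CFP.hom_ext hfstζ ?_))).elim
      obtain ⟨i, hi⟩ := T.hom_ce_eq ζ.hom.snd
      change T.sw ≫ ζ.hom.snd = 𝟙 T.c ≫ ζ.hom.snd
      rw [hi, T.sw_comp_cst, Category.id_comp]

/-- **The identity of an object of `A_T` over `c` is a mono-minimal quotient by the trivial group.**
[cite: MochizukiFrdI2008, §0 p.18] -/
theorem isMonoMinimalQuotientA_bot_id_over_c (X₀ : C0)
    (ι : (PreFrobenioid.baseFunctor C0.toElem).obj X₀ ≅ D0.complex) :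
    IsMonoMinimalQuotient (⊥ : Subgroup (Aut (⟨⟨X₀, T.c, ι⟩⟩ : A toD0))) (𝟙 _) := by
  refine ⟨⟨fun γ hγ => ?_, fun X ψ _ => ⟨ψ, Category.id_comp ψ, fun ψ' hψ' => ?_⟩⟩,
    fun A' ζ φ' hfac _ _ => ?_⟩
  · rw [Subgroup.mem_bot] at hγ
    subst hγ
    exact Category.id_comp _
  · rw [← hψ', Category.id_comp]
  · obtain ⟨⟨A₀, a, ιA⟩⟩ := A'
    cases a with
    | c =>
      haveI : IsIso ζ.hom.snd := T.isIso_hom_cc ζ.hom.snd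
      have h1 : ζ.hom.fst ≫ φ'.hom.fst = 𝟙 _ := by
        have h := congrArg (fun k => k.hom.fst) hfac
        change (ζ.hom ≫ φ'.hom).fst = 𝟙 _ at h
        rwa [CFP.comp_fst] at h
      haveI : IsSplitMono ζ.hom.fst := IsSplitMono.mk' ⟨φ'.hom.fst, h1⟩
      haveI : Epi ζ.hom.fst := C0.isTotallyEpimorphic.epi ζ.hom.fst
      haveI : IsIso ζ.hom.fst := isIso_of_epi_of_isSplitMono ζ.hom.fst
      haveI : IsIso ζ.hom := CFP.isIso_of_isIso_fst_snd ζ.hom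
      exact A.isIso_of_isIso_hom ζ
    | p => exact (T.isEmpty_hom_pc.false φ'.hom.snd).elim
    | e => exact (T.isEmpty_hom_ec.false φ'.hom.snd).elim

/-- **The identity of an object of `A_T` over `e` is a mono-minimal quotient by the trivial group.**
[cite: MochizukiFrdI2008, §0 p.18] -/
theorem isMonoMinimalQuotientA_bot_id_over_e (X₀ : C0)
    (ι : (PreFrobenioid.baseFunctor C0.toElem).obj X₀ ≅ D0.complex) :
    IsMonoMinimalQuotient (⊥ : Subgroup (Aut (⟨⟨X₀, T.e, ι⟩⟩ : A toD0))) (𝟙 _) := by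
  refine ⟨⟨fun γ hγ => ?_, fun X ψ _ => ⟨ψ, Category.id_comp ψ, fun ψ' hψ' => ?_⟩⟩,
    fun A' ζ φ' hfac _ _ => ?_⟩
  · rw [Subgroup.mem_bot] at hγ
    subst hγ
    exact Category.id_comp _
  · rw [← hψ', Category.id_comp]
  · obtain ⟨⟨A₀, a, ιA⟩⟩ := A'
    have hsnd : ζ.hom.snd ≫ φ'.hom.snd = 𝟙 T.e := by
      have h := congrArg (fun k => k.hom.snd) hfac
      change (ζ.hom ≫ φ'.hom).snd = 𝟙 _ at h
      rwa [CFP.comp_snd] at h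
    have h1 : ζ.hom.fst ≫ φ'.hom.fst = 𝟙 _ := by
      have h := congrArg (fun k => k.hom.fst) hfac
      change (ζ.hom ≫ φ'.hom).fst = 𝟙 _ at h
      rwa [CFP.comp_fst] at h
    haveI : IsSplitMono ζ.hom.fst := IsSplitMono.mk' ⟨φ'.hom.fst, h1⟩
    haveI : Epi ζ.hom.fst := C0.isTotallyEpimorphic.epi ζ.hom.fst
    haveI : IsIso ζ.hom.fst := isIso_of_epi_of_isSplitMono ζ.hom.fst
    cases a with
    | c => exact (T.isEmpty_hom_ec.false ζ.hom.snd).elim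
    | p =>
      exfalso
      obtain ⟨i, hi⟩ := T.hom_pe_eq φ'.hom.snd
      rw [Subsingleton.elim ζ.hom.snd T.ret, hi, T.ret_comp_sec, T.id_e] at hsnd
      exact T.const_ne_id i (T.emap_injective hsnd)
    | e =>
      obtain ⟨g, hg⟩ := T.hom_ee_eq ζ.hom.snd
      obtain ⟨g', hg'⟩ := T.hom_ee_eq φ'.hom.snd
      rw [hg, hg'] at hsnd
      haveI : IsIso ζ.hom.snd := hg ▸ T.isIso_emap_of_comp_eq_id hsnd
      haveI : IsIso ζ.hom := CFP.isIso_of_isIso_fst_snd ζ.hom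
      exact A.isIso_of_isIso_hom ζ

/-! ### `A_T` is of RC-iso-subanchor type; the refutation; the dichotomy for (iv) -/

/-- **`A_T` IS OF RC-ISO-SUBANCHOR TYPE.** [cite: MochizukiFrdII2008, Prop 3.5 (iv) p.34] -/
theorem isOfRCIsoSubanchorType_A : RC.IsOfRCIsoSubanchorType (A.rcOf toD0) := by
  refine ⟨fun X => ?_⟩
  obtain ⟨⟨X₀, x, ι⟩⟩ := X
  cases x with
  | c => exact ⟨_, ⊥, 𝟙 _, isRCSubanchor_A _, isMonoMinimalQuotientA_bot_id_over_c X₀ ι⟩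
  | p =>
    obtain ⟨G, hG⟩ := exists_isMonoMinimalQuotientA_over_p X₀ ι
    exact ⟨⟨⟨X₀, T.c, ι⟩⟩, G, _, isRCSubanchor_A _, hG⟩
  | e => exact ⟨_, ⊥, 𝟙 _, isRCSubanchor_A _, isMonoMinimalQuotientA_bot_id_over_e X₀ ι⟩

/-- **[FrdII] Prop. 3.5 (iv) as typed FAILS for `A` over the connected toy base.**
[cite: MochizukiFrdII2008, Prop 3.5 (iv) p.34] -/
theorem not_prop35iv_A : ¬ Literature.AlgebraicGeometry.Frobenioids.ArchFrd.Prop35iv_A toD0 := fun h =>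
  h isOfRCIsoSubanchorType_toD0 isOfRCIsoSubanchorType_A

/-- **Connectedness of the base is not enough for the typed Prop. 3.5 (iv) for `A`** (FACT-LIST F-0865).
[cite: MochizukiFrdII2008, Prop 3.5 (iv) p.34] -/
theorem not_forall_prop35iv_A_of_isGraphConnected :
    ¬ ∀ (D : Type) [Category.{0} D] (π : D ⥤ D0), IsGraphConnected D →
      Literature.AlgebraicGeometry.Frobenioids.ArchFrd.Prop35iv_A π :=
  fun h => not_prop35iv_A (h T toD0 T.isGraphConnected)

/-- **Packaged witness for `A`.** [cite: MochizukiFrdII2008, Prop 3.5 (iv) p.34] -/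
theorem exists_connected_base_not_prop35iv_A :
    ∃ (D : Type) (_ : Category.{0} D) (π : D ⥤ D0), IsGraphConnected D ∧ ¬ IsTotallyEpimorphic D ∧
      RC.IsOfRCIsoSubanchorType (baseRC π) ∧ RC.IsOfRCIsoSubanchorType (A.rcOf π) ∧
        ¬ Literature.AlgebraicGeometry.Frobenioids.ArchFrd.Prop35iv_A π :=
  ⟨T, inferInstance, toD0, T.isGraphConnected, T.not_isTotallyEpimorphic, isOfRCIsoSubanchorType_toD0,
    isOfRCIsoSubanchorType_A, not_prop35iv_A⟩

end P35iiToy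

/-- **DICHOTOMY for [FrdII] Prop. 3.5 (iv) as typed (FACT-LIST F-0865/F-0866, exact dependence on the base).**
(1) Over every NONEMPTY base `D → D₀` whose split monomorphisms are invertible, both `Prop35iv_C π` and
`Prop35iv_A π` hold; (2) there is a CONNECTED base of RC-iso-subanchor type with a split monomorphism that is
NOT invertible over which BOTH fail (the toy base `T`). [cite: MochizukiFrdII2008, Prop 3.5 (iv) p.34] -/
theorem prop35iv_splitMono_dichotomy :
    (∀ (D : Type u) [Category.{v} D] [Nonempty D] (π : D ⥤ D0),
        (∀ ⦃a b : D⦄ (s : a ⟶ b), IsSplitMono s → IsIso s) →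
          Literature.AlgebraicGeometry.Frobenioids.ArchFrd.Prop35iv_C π ∧
            Literature.AlgebraicGeometry.Frobenioids.ArchFrd.Prop35iv_A π) ∧
      ∃ (D : Type) (_ : Category.{0} D) (π : D ⥤ D0) (a b : D) (s : a ⟶ b),
        IsGraphConnected D ∧ RC.IsOfRCIsoSubanchorType (baseRC π) ∧ IsSplitMono s ∧ ¬ IsIso s ∧
          ¬ Literature.AlgebraicGeometry.Frobenioids.ArchFrd.Prop35iv_C π ∧
            ¬ Literature.AlgebraicGeometry.Frobenioids.ArchFrd.Prop35iv_A π :=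
  ⟨fun _ _ _ π hD => ⟨prop35iv_C_of_splitMono π hD, prop35iv_A_of_splitMono π hD⟩,
    ⟨P35iiToy.T, inferInstance, P35iiToy.toD0, P35iiToy.T.p, P35iiToy.T.e, P35iiToy.T.sec false,
      P35iiToy.T.isGraphConnected, P35iiToy.isOfRCIsoSubanchorType_toD0, P35iiToy.T.isSplitMono_sec false,
      P35iiToy.T.not_isIso_sec false, P35iiToy.not_prop35iv_C, P35iiToy.not_prop35iv_A⟩⟩

end ArchFrd

end

end Literature.AlgebraicGeometry.Frobenioids
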